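import Summits.QuantumFields.BalabanUV.Beta.CombMixedT2EvenStoreyRec
import Summits.QuantumFields.BalabanUV.Beta.CombMixedT2EvenStoreyTwoPeriodised
import Summits.QuantumFields.BalabanUV.Beta.CompositeOneShotJets
import Summits.QuantumFields.BalabanUV.Beta.CompositeVertexKernelLiftKernel

/-!
# `BalabanUV.Beta.CombMixedT2EvenStoreyPeriodised` — binder row D1 ∕ (C1), PART 33a: **THE COARSE-SLOT-PERIODISED EVEN COMPOSITE MIXED TABLE OF ANY DEPTH `m` —
# LETTERS, PERIOD COVARIANCE (`M = Lc^m·M′`), WINDOWS, AND PART 32's RECURSION PER COPY** (PART 31a `CombMixedT2EvenStoreyTwoPeriodised` one composite up: the same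
# letters with `2 ↦ m`, and §3 = PART 32's storeywise recursion at depth `m+1` in the table's letters instead of PART 30's closed depth-2 form; consumed by PART 33b
# `CombMixedT2EvenStoreyTorus`, the torus recursion at every depth)

WHY (J-NOTE-14 §3∕§5; road FP A-3 → v7 storeywise at EVERY box `n`, composite depth `n + 2`).  PART 31 settled the torus form at depth 2 (v5's `n = 0`); PART 32 gave the lattice
recursion at every depth.  This file is PART 31a verbatim at depth `m` (the F6c∕F6d letters `compMixKer_eq_zero_* ∕ compMix_hmixt` are depth-generic) plus the per-copy form of
PART 32's recursion: the lattice contraction of the depth-(m+1) even table at a coarse bond is `wM2 ·` the top-storey word plus the top linear brick times the SAME contraction of the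
depth-`m` even tables at the window bonds (§3) — the shape PART 33b periodises.

WHAT (`d = 3`, centred root, weight `wM2 3 L₂ j` free; [folklore] re-indexing BY NAME; no `def`, no `def … : Prop`, nothing cited, 0 sorry):
* §1 (depth `m`) `compMix_inl_inl`, `compMixedT2_even_inl_inl`, the three `winF (Lc^m) (wid Lc m)` windows, the cube letters `…_of_not_mem_T ∕ _S`, `compMixedT2_even_translate`.
* §2 (depth `m`, `hM : M = Lc^m·M′`) `summable_compMixedT2_even_translate_inl_inl`, **`compMixedT2per_even_periodCov`**, the windows `hT ∕ hS`, **`tsum_sum_dz_mul_compMixedT2per_even_inl_inl`**.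
* §3 (depth `m+1`) **`tsum_sum_dz_mul_compMixedT2_even_succ_inl_inl`**: `Σ'_u Σ_κ (λ(u+e_κ) − λ u)·M2ᵉ_{m+1} κ u ρ′ y x z (inl α) (inl γ)
  = wM2 · Σ_{κ₁e₁κ₂e₂} (λ(R_m(Lc•y+e₂)) − λ(R_m(Lc•y+e₁)))·h(ρ′,y;b₁,b₂)·compLin_m((α,x);b₁)·compLin_m((γ,z);b₂) + Σ_{κ,e} ℓ(ρ′,y;b)·Σ'_u Σ_κ′ (λ(u+e_κ′) − λ u)·M2ᵉ_m κ′ u κ (Lc•y+e) x z (inl α) (inl γ)`.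
WHAT THIS IS NOT: not the torus fold (PART 33b); nothing of Bałaban's asserted, valued or discharged; 0 estimates; 0∕4 row-D1 binders (hW, hR, D1Tel, D1Rep); ROOT M‴ p325680 ∕ P5c ∕ D6
untouched; NOT (C1), NOT (T-ID), NOT D1, NEVER «G-an2-4 closed», NOT BetaPertH, NOT continuum, NOT Clay.

HONEST DEPENDENCY (page 1, mandatory): continuum YM on T⁴ ⇐ BetaPertH ∧ nine spine estimates (0/9 proved); BetaPertH ⇐ (D1) ∧ (D4) ∧ CAP+tail;
G-an2-4 gates asym, D1 and NE2/3/4.  HONEST FRAMING (cell contract, verbatim): «discharging `BetaPertH` makes Bałaban's UV stability UNCONDITIONAL —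
a real constructive-QFT result; it is NOT the continuum limit and NOT the Clay problem.»  ABSOLUTE RULE (cell charter, verbatim): «No internally-minted
statement may enter as a cited fact. Every hypothesis is either kernel-proved in this package or a verbatim quotation of a PUBLISHED theorem with page
reference. The manuscript(s) under audit are NOT citable for their own disputed steps — they are the thing under adjudication; programme-internal
(2001/route/tribunal) claims are never citable.»  Row D1 ∕ (C1) OWNER an2 (b2b-balaban-beta-an2) gen 71, 2026-08-28.  §1∕§2 = PART 31a §1∕§2 at depth `m` (same proofs; the depth-free cube letter `sub_mem_piFinset_of_mem_winF` is 31a's, imported).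
No existing file touched.
-/

noncomputable section

open scoped BigOperators

namespace Summit.QuantumFields.BalabanUV.Beta.CombMixedT2EvenStoreyPeriodised

open Finset Matrix
open Literature.MathematicalPhysics.QuantumFieldTheory
open Literature.MathematicalPhysics.QuantumFieldTheory.Balaban1983to89
open Literature.MathematicalPhysics.QuantumFieldTheory.Balaban1983to89.Beta
open B4TorusKernel.MultiPeriod (translate translate_apply)
open B4Reflection242 (translate_translate)
open B6Lemma24Torus (pbox mem_pbox)
open ExpKernelCalculus (MKer shiftK)
open AffineAveraging (Site box toSite unitVec dz)
open AveragingContoursRooted (ctr ctrOff ctrOff_mem_box)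
open AveragingHessianKernels (Bond Near)
open OneStepResolventKernel (Fib)
open BalabanStepW2 (M2Of wM2)
open Summit.QuantumFields.BalabanUV.Beta.TameKernelCalculus (trK trK_apply)
open Summit.QuantumFields.BalabanUV.Beta.BorderedHessian (sgnK sgnK_apply sgnF_inl)
open Summit.QuantumFields.BalabanUV.Beta.AxialDressingRooted (one_le_of_neZero)
open Summit.QuantumFields.BalabanUV.Beta.WardLocusParityLevels (M2Of_apply)
open Summit.QuantumFields.BalabanUV.Beta.SymAveragingHessianCounts (symLinKerAt symVhKerAt symHessKerAt)
open Summit.QuantumFields.BalabanUV.Beta.SymAveragingMixedJetTables (symMixKerAt)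
open Summit.QuantumFields.BalabanUV.Beta.CompositeVertexKernelRec (offs winF wid mem_winF_iff compLinKer)
open Summit.QuantumFields.BalabanUV.Beta.CompositeVertexKernelLiftKernel (mem_piFinset_of_mem_winF)
open Summit.QuantumFields.BalabanUV.Beta.CompositeMixedTable (compMixKer compMixKer_eq_zero_bg compMixKer_eq_zero_left compMixKer_eq_zero_right)
open Summit.QuantumFields.BalabanUV.Beta.CompositeOneShotJets (compMix compMix_hmixt)
open Summit.QuantumFields.BalabanUV.Beta.CombMixedT2EvenStoreyRec (tsum_sum_grad_mul_compMixKer_succ_even)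
open Summit.QuantumFields.BalabanUV.Beta.CombMixedT2EvenStoreyTwoPeriodised (sub_mem_piFinset_of_mem_winF)
open Summit.QuantumFields.BalabanUV.Beta.FP.KernelPeriodisationFib (Idx perF perF_apply perZ perZ_apply translate_eq_add)
open Summit.QuantumFields.BalabanUV.Beta.FP.KernelPeriodisationFibLoc (dper dper_apply)
open Summit.QuantumFields.BalabanUV.Beta.FP.KernelPeriodisationFibTrace (tsum_sites_eq_sum_tsum)
open Summit.QuantumFields.BalabanUV.Beta.FP.TorusGaugeCovariance (tdelta tdelta_translate tgrad tgrad_inl)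
open Summit.QuantumFields.BalabanUV.Beta.FP.PeriodisedBorderIndexWard (translate_injective)
open Summit.QuantumFields.BalabanUV.Beta.FP.PeriodisedBorderTables (translate_eq_add_smul)
open Summit.QuantumFields.BalabanUV.Beta.CombWilsonT2Periodised (dper_apply_of_periodCov translate_eq_translate_sub_add)

variable {Lc : ℕ} [NeZero Lc]

/-! ## §1 Letters of the even COMPOSITE mixed table of depth `m` on the `(inl, inl)` block: entry, windows, geometry, covariance -/

section Letters

variable (L₂ j m : ℕ)

omit [NeZero Lc] in
/-- [folklore] the packed composite mixed table's field–field entries ARE the composite mixed kernel over an1's sym bricks at the centred root (`rfl`;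
`toSite (ctrOff 4 Lc) = ctr 4 Lc`). -/
theorem compMix_inl_inl (κ : Fin (3 + 1)) (u : Site (3 + 1)) (ρ' : Fin (3 + 1)) (w x z : Site (3 + 1)) (α γ : Fin (3 + 1)) :
    compMix (ctrOff (3 + 1) Lc) Lc m κ u ρ' w x z (Sum.inl α) (Sum.inl γ)
      = compMixKer (fun _ => symLinKerAt (ctr 4 Lc) Lc) (fun _ => symVhKerAt (ctr 4 Lc) Lc) (fun _ => symHessKerAt (ctr 4 Lc) Lc)
          (fun _ => symMixKerAt (ctr 4 Lc) Lc) Lc m ρ' w (κ, u) (α, x) (γ, z) := rfl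

omit [NeZero Lc] in
/-- [folklore] **THE `(inl α, inl γ)` ENTRY OF THE EVEN COMPOSITE MIXED TABLE** (depth `m`, weight index `j` at blocking `L₂`):
`M2ᵉ κ u ρ′ w x z (inl α) (inl γ) = wM2 L₂ j · ½·(compMix₂(ρ′,w;(κ,u))(x,z)_{αγ} + compMix₂(ρ′,w;(κ,u))(z,x)_{γα})` (`M2Of_apply`, `sgnF (inl ·) = 1`). -/
theorem compMixedT2_even_inl_inl (κ : Fin (3 + 1)) (u : Site (3 + 1)) (ρ' : Fin (3 + 1)) (w x z : Site (3 + 1)) (α γ : Fin (3 + 1)) :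
    ((1 / 2 : ℝ) • (M2Of 3 L₂ (compMix (ctrOff (3 + 1) Lc) Lc m) j κ u ρ' w + sgnK (trK (M2Of 3 L₂ (compMix (ctrOff (3 + 1) Lc) Lc m) j κ u ρ' w)))) x z
        (Sum.inl α) (Sum.inl γ)
      = wM2 3 L₂ j * ((1 / 2 : ℝ) * (compMix (ctrOff (3 + 1) Lc) Lc m κ u ρ' w x z (Sum.inl α) (Sum.inl γ)
          + compMix (ctrOff (3 + 1) Lc) Lc m κ u ρ' w z x (Sum.inl γ) (Sum.inl α))) := by
  simp only [Pi.smul_apply, Pi.add_apply, smul_eq_mul, sgnK_apply, trK_apply, sgnF_inl, M2Of_apply, one_mul]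
  ring

omit [NeZero Lc] in
/-- [folklore] LEFT-LEG WINDOW of the composite mixed table (F6c `compMixKer_eq_zero_left`): zero unless `x ∈ winF (Lc^m) (wid Lc m) w`. -/
theorem compMix_inl_inl_eq_zero_of_left (κ : Fin (3 + 1)) (u : Site (3 + 1)) (ρ' : Fin (3 + 1)) (w : Site (3 + 1)) {x : Site (3 + 1)}
    (hx : x ∉ winF (Lc ^ m) (wid Lc m) w) (z : Site (3 + 1)) (α γ : Fin (3 + 1)) :
    compMix (ctrOff (3 + 1) Lc) Lc m κ u ρ' w x z (Sum.inl α) (Sum.inl γ) = 0 := by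
  rw [compMix_inl_inl]
  exact compMixKer_eq_zero_left m (κ, u) (f := (α, x)) (γ, z) hx

omit [NeZero Lc] in
/-- [folklore] RIGHT-LEG WINDOW (F6c `compMixKer_eq_zero_right`): zero unless `z ∈ winF (Lc^m) (wid Lc m) w`. -/
theorem compMix_inl_inl_eq_zero_of_right (κ : Fin (3 + 1)) (u : Site (3 + 1)) (ρ' : Fin (3 + 1)) (w x : Site (3 + 1)) {z : Site (3 + 1)}
    (hz : z ∉ winF (Lc ^ m) (wid Lc m) w) (α γ : Fin (3 + 1)) :
    compMix (ctrOff (3 + 1) Lc) Lc m κ u ρ' w x z (Sum.inl α) (Sum.inl γ) = 0 := by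
  rw [compMix_inl_inl]
  exact compMixKer_eq_zero_right m (κ, u) (α, x) (f' := (γ, z)) hz

omit [NeZero Lc] in
/-- [folklore] FINE-BOND WINDOW (F6c `compMixKer_eq_zero_bg`): zero unless `u ∈ winF (Lc^m) (wid Lc m) w`. -/
theorem compMix_inl_inl_eq_zero_of_bond (κ : Fin (3 + 1)) {u : Site (3 + 1)} (ρ' : Fin (3 + 1)) (w : Site (3 + 1))
    (hu : u ∉ winF (Lc ^ m) (wid Lc m) w) (x z : Site (3 + 1)) (α γ : Fin (3 + 1)) :
    compMix (ctrOff (3 + 1) Lc) Lc m κ u ρ' w x z (Sum.inl α) (Sum.inl γ) = 0 := by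
  rw [compMix_inl_inl]
  exact compMixKer_eq_zero_bg m (g := (κ, u)) (α, x) (γ, z) hu

omit [NeZero Lc] in
/-- [folklore] LEFT-LEG WINDOW of the even table's `ff` entries. -/
theorem compMixedT2_even_inl_inl_eq_zero_of_left (κ : Fin (3 + 1)) (u : Site (3 + 1)) (ρ' : Fin (3 + 1)) (w : Site (3 + 1)) {x : Site (3 + 1)}
    (hx : x ∉ winF (Lc ^ m) (wid Lc m) w) (z : Site (3 + 1)) (α γ : Fin (3 + 1)) :
    ((1 / 2 : ℝ) • (M2Of 3 L₂ (compMix (ctrOff (3 + 1) Lc) Lc m) j κ u ρ' w + sgnK (trK (M2Of 3 L₂ (compMix (ctrOff (3 + 1) Lc) Lc m) j κ u ρ' w)))) x z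
        (Sum.inl α) (Sum.inl γ) = 0 := by
  rw [compMixedT2_even_inl_inl, compMix_inl_inl_eq_zero_of_left m κ u ρ' w hx, compMix_inl_inl_eq_zero_of_right m κ u ρ' w z hx]
  ring

omit [NeZero Lc] in
/-- [folklore] RIGHT-LEG WINDOW of the even table's `ff` entries. -/
theorem compMixedT2_even_inl_inl_eq_zero_of_right (κ : Fin (3 + 1)) (u : Site (3 + 1)) (ρ' : Fin (3 + 1)) (w x : Site (3 + 1)) {z : Site (3 + 1)}
    (hz : z ∉ winF (Lc ^ m) (wid Lc m) w) (α γ : Fin (3 + 1)) :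
    ((1 / 2 : ℝ) • (M2Of 3 L₂ (compMix (ctrOff (3 + 1) Lc) Lc m) j κ u ρ' w + sgnK (trK (M2Of 3 L₂ (compMix (ctrOff (3 + 1) Lc) Lc m) j κ u ρ' w)))) x z
        (Sum.inl α) (Sum.inl γ) = 0 := by
  rw [compMixedT2_even_inl_inl, compMix_inl_inl_eq_zero_of_right m κ u ρ' w x hz, compMix_inl_inl_eq_zero_of_left m κ u ρ' w hz]
  ring

omit [NeZero Lc] in
/-- [folklore] FINE-BOND (family index) WINDOW of the even table's `ff` entries. -/
theorem compMixedT2_even_inl_inl_eq_zero_of_bond (κ : Fin (3 + 1)) {u : Site (3 + 1)} (ρ' : Fin (3 + 1)) (w : Site (3 + 1))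
    (hu : u ∉ winF (Lc ^ m) (wid Lc m) w) (x z : Site (3 + 1)) (α γ : Fin (3 + 1)) :
    ((1 / 2 : ℝ) • (M2Of 3 L₂ (compMix (ctrOff (3 + 1) Lc) Lc m) j κ u ρ' w + sgnK (trK (M2Of 3 L₂ (compMix (ctrOff (3 + 1) Lc) Lc m) j κ u ρ' w)))) x z
        (Sum.inl α) (Sum.inl γ) = 0 := by
  rw [compMixedT2_even_inl_inl, compMix_inl_inl_eq_zero_of_bond m κ ρ' w hu, compMix_inl_inl_eq_zero_of_bond m κ ρ' w hu]
  ring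

omit [NeZero Lc] in
/-- [folklore] the even table's `ff` entry at a coarse bond `(ρ′, y)` vanishes unless the fine bond's site lies in the cube window `x − Π_i [−W_m, W_m]` of the LEFT
fluctuation site (`W_m = wid Lc m`; uniform in the coarse bond — the letter `hT` for every copy at once). -/
theorem compMixedT2_even_inl_inl_eq_zero_of_not_mem_T (κ : Fin (3 + 1)) (ρ' : Fin (3 + 1)) (y x z : Site (3 + 1)) (α γ : Fin (3 + 1)) :
    ∀ u ∉ (Fintype.piFinset fun _ : Fin (3 + 1) => Finset.Icc (-(wid Lc m : ℤ)) (wid Lc m : ℤ)).image (fun v => x - v),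
      ((1 / 2 : ℝ) • (M2Of 3 L₂ (compMix (ctrOff (3 + 1) Lc) Lc m) j κ u ρ' y + sgnK (trK (M2Of 3 L₂ (compMix (ctrOff (3 + 1) Lc) Lc m) j κ u ρ' y)))) x z
        (Sum.inl α) (Sum.inl γ) = 0 := fun u hu => by
  by_cases hx : x ∈ winF (Lc ^ m) (wid Lc m) y
  · exact compMixedT2_even_inl_inl_eq_zero_of_bond L₂ j m κ ρ' y
      (fun hu' => hu (Finset.mem_image.2 ⟨x - u, sub_mem_piFinset_of_mem_winF hx hu', sub_sub_cancel x u⟩)) x z α γ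
  · exact compMixedT2_even_inl_inl_eq_zero_of_left L₂ j m κ u ρ' y hx z α γ

omit [NeZero Lc] in
/-- [folklore] … and unless the RIGHT fluctuation site lies in the same cube window of the left one (the letter `hS` for every copy at once). -/
theorem compMixedT2_even_inl_inl_eq_zero_of_not_mem_S (κ : Fin (3 + 1)) (u : Site (3 + 1)) (ρ' : Fin (3 + 1)) (y x : Site (3 + 1)) (α γ : Fin (3 + 1)) :
    ∀ z ∉ (Fintype.piFinset fun _ : Fin (3 + 1) => Finset.Icc (-(wid Lc m : ℤ)) (wid Lc m : ℤ)).image (fun v => x - v),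
      ((1 / 2 : ℝ) • (M2Of 3 L₂ (compMix (ctrOff (3 + 1) Lc) Lc m) j κ u ρ' y + sgnK (trK (M2Of 3 L₂ (compMix (ctrOff (3 + 1) Lc) Lc m) j κ u ρ' y)))) x z
        (Sum.inl α) (Sum.inl γ) = 0 := fun z hz => by
  by_cases hx : x ∈ winF (Lc ^ m) (wid Lc m) y
  · exact compMixedT2_even_inl_inl_eq_zero_of_right L₂ j m κ u ρ' y x
      (fun hz' => hz (Finset.mem_image.2 ⟨x - z, sub_mem_piFinset_of_mem_winF hx hz', sub_sub_cancel x z⟩)) α γ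
  · exact compMixedT2_even_inl_inl_eq_zero_of_left L₂ j m κ u ρ' y hx z α γ

omit [NeZero Lc] in
/-- [folklore] **JOINT BLOCK COVARIANCE OF THE EVEN COMPOSITE TABLE** at blocking `Lc^m` (F6d `compMix_hmixt`; `sgnK`, `trK`, scalars commute with `shiftK`):
`M2ᵉ κ (u + Lc^m•t) ρ′ (w + t) (x + Lc^m•t) (z + Lc^m•t) a c = M2ᵉ κ u ρ′ w x z a c`. -/
theorem compMixedT2_even_translate (κ : Fin (3 + 1)) (u : Site (3 + 1)) (ρ' : Fin (3 + 1)) (w t x z : Site (3 + 1)) (a c : Fib 3) :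
    ((1 / 2 : ℝ) • (M2Of 3 L₂ (compMix (ctrOff (3 + 1) Lc) Lc m) j κ (u + ((Lc ^ m : ℕ) : ℤ) • t) ρ' (w + t)
        + sgnK (trK (M2Of 3 L₂ (compMix (ctrOff (3 + 1) Lc) Lc m) j κ (u + ((Lc ^ m : ℕ) : ℤ) • t) ρ' (w + t)))))
        (x + ((Lc ^ m : ℕ) : ℤ) • t) (z + ((Lc ^ m : ℕ) : ℤ) • t) a c
      = ((1 / 2 : ℝ) • (M2Of 3 L₂ (compMix (ctrOff (3 + 1) Lc) Lc m) j κ u ρ' w + sgnK (trK (M2Of 3 L₂ (compMix (ctrOff (3 + 1) Lc) Lc m) j κ u ρ' w)))) x z a c := by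
  simp only [Pi.smul_apply, Pi.add_apply, smul_eq_mul, sgnK_apply, trK_apply, M2Of_apply, compMix_hmixt]
  simp only [shiftK, add_neg_cancel_right]

end Letters

/-! ## §2 The coarse-slot-periodised even composite bi-family (depth `m`): copies, period covariance, windows -/

section Family

variable {M M' : Fin (3 + 1) → ℕ} [∀ μ, NeZero (M μ)] [∀ μ, NeZero (M' μ)] (L₂ j m : ℕ) (ρ' : Fin (3 + 1)) (w : Site (3 + 1))
  {V : Fin (3 + 1) → Site (3 + 1) → MKer (3 + 1) (Fib 3)}

omit [∀ μ, NeZero (M μ)] in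
/-- [folklore] the COARSE-period copies of the multiplier bond whose depth-`m` window contains a given fluctuation site are finitely many: on the `(inl, inl)` block
`n ↦ M2ᵉ κ u ρ′ (w + M′∘n) x z (inl α) (inl γ)` is summable (left-leg window; F6a″ `mem_piFinset_of_mem_winF`; `n ↦ w + M′∘n` injective). -/
theorem summable_compMixedT2_even_translate_inl_inl (κ : Fin (3 + 1)) (u x z : Site (3 + 1)) (α γ : Fin (3 + 1)) :
    Summable fun n : Site (3 + 1) =>
      ((1 / 2 : ℝ) • (M2Of 3 L₂ (compMix (ctrOff (3 + 1) Lc) Lc m) j κ u ρ' (translate M' w n)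
          + sgnK (trK (M2Of 3 L₂ (compMix (ctrOff (3 + 1) Lc) Lc m) j κ u ρ' (translate M' w n))))) x z (Sum.inl α) (Sum.inl γ) := by
  have hL : 0 < Lc ^ m := Nat.pos_of_ne_zero (NeZero.ne _)
  refine summable_of_ne_finset_zero
    (s := (Fintype.piFinset fun i => Finset.Icc ((x i - (wid Lc m : ℤ)) / ((Lc ^ m : ℕ) : ℤ)) (x i / ((Lc ^ m : ℕ) : ℤ))).preimage _
      (translate_injective (M := M') w).injOn) fun n hn => ?_
  exact compMixedT2_even_inl_inl_eq_zero_of_left L₂ j m κ u ρ' _ (fun hx => hn (Finset.mem_preimage.2 (mem_piFinset_of_mem_winF hL hx))) z α γ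

omit [NeZero Lc] [∀ μ, NeZero (M μ)] [∀ μ, NeZero (M' μ)] in
/-- [folklore] **JOINT INVARIANCE UNDER THE PERIOD LATTICE OF `M = Lc^m·M′`** of the coarse-slot-periodised even composite bi-family
`V κ u := Σ'_n M2ᵉ κ u ρ′ (w + M′∘n)`: `V κ (u + M∘m) (x + M∘m) (z + M∘m) = V κ u x z` (§1's covariance per copy with `t := M′∘m`, re-indexing `n ↦ n − m`). -/
theorem compMixedT2per_even_periodCov (hM : ∀ i, M i = Lc ^ m * M' i)
    (hV : V = fun κ u x z a c => ∑' n : Site (3 + 1),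
      ((1 / 2 : ℝ) • (M2Of 3 L₂ (compMix (ctrOff (3 + 1) Lc) Lc m) j κ u ρ' (translate M' w n)
          + sgnK (trK (M2Of 3 L₂ (compMix (ctrOff (3 + 1) Lc) Lc m) j κ u ρ' (translate M' w n))))) x z a c)
    (κ : Fin (3 + 1)) (u n₀ x z : Site (3 + 1)) (a c : Fib 3) :
    V κ (translate M u n₀) (translate M x n₀) (translate M z n₀) a c = V κ u x z a c := by
  subst hV
  show (∑' n : Site (3 + 1), ((1 / 2 : ℝ) • (M2Of 3 L₂ (compMix (ctrOff (3 + 1) Lc) Lc m) j κ (translate M u n₀) ρ' (translate M' w n)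
          + sgnK (trK (M2Of 3 L₂ (compMix (ctrOff (3 + 1) Lc) Lc m) j κ (translate M u n₀) ρ' (translate M' w n))))) (translate M x n₀) (translate M z n₀) a c)
      = ∑' n : Site (3 + 1), ((1 / 2 : ℝ) • (M2Of 3 L₂ (compMix (ctrOff (3 + 1) Lc) Lc m) j κ u ρ' (translate M' w n)
          + sgnK (trK (M2Of 3 L₂ (compMix (ctrOff (3 + 1) Lc) Lc m) j κ u ρ' (translate M' w n))))) x z a c
  rw [← (Equiv.subRight n₀).tsum_eq fun n => ((1 / 2 : ℝ) • (M2Of 3 L₂ (compMix (ctrOff (3 + 1) Lc) Lc m) j κ u ρ' (translate M' w n)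
          + sgnK (trK (M2Of 3 L₂ (compMix (ctrOff (3 + 1) Lc) Lc m) j κ u ρ' (translate M' w n))))) x z a c]
  refine tsum_congr fun n => ?_
  rw [Equiv.subRight_apply, translate_eq_add_smul hM u n₀, translate_eq_add_smul hM x n₀, translate_eq_add_smul hM z n₀,
    translate_eq_translate_sub_add M' w n n₀]
  exact compMixedT2_even_translate L₂ j m κ u ρ' (translate M' w (n - n₀)) (fun i => (M' i : ℤ) * n₀ i) x z a c

omit [NeZero Lc] [∀ μ, NeZero (M μ)] [∀ μ, NeZero (M' μ)] in
/-- [folklore] window letter `hT` (fine bond = family index): on the `(inl, inl)` block `V κ u x z` vanishes unless `u ∈ x − Π_i [−W_m, W_m]`. -/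
theorem compMixedT2per_even_inl_inl_eq_zero_of_not_mem_T
    (hV : V = fun κ u x z a c => ∑' n : Site (3 + 1),
      ((1 / 2 : ℝ) • (M2Of 3 L₂ (compMix (ctrOff (3 + 1) Lc) Lc m) j κ u ρ' (translate M' w n)
          + sgnK (trK (M2Of 3 L₂ (compMix (ctrOff (3 + 1) Lc) Lc m) j κ u ρ' (translate M' w n))))) x z a c)
    (κ : Fin (3 + 1)) (x z : Site (3 + 1)) (α γ : Fin (3 + 1)) :
    ∀ u ∉ (Fintype.piFinset fun _ : Fin (3 + 1) => Finset.Icc (-(wid Lc m : ℤ)) (wid Lc m : ℤ)).image (fun v => x - v),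
      V κ u x z (Sum.inl α) (Sum.inl γ) = 0 := fun u hu => by
  subst hV
  exact (tsum_congr fun n => compMixedT2_even_inl_inl_eq_zero_of_not_mem_T L₂ j m κ ρ' _ x z α γ u hu).trans tsum_zero

omit [NeZero Lc] [∀ μ, NeZero (M μ)] [∀ μ, NeZero (M' μ)] in
/-- [folklore] window letter `hS` (right fluctuation leg): on the `(inl, inl)` block `V κ u x z` vanishes unless `z ∈ x − Π_i [−W_m, W_m]`. -/
theorem compMixedT2per_even_inl_inl_eq_zero_of_not_mem_S
    (hV : V = fun κ u x z a c => ∑' n : Site (3 + 1),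
      ((1 / 2 : ℝ) • (M2Of 3 L₂ (compMix (ctrOff (3 + 1) Lc) Lc m) j κ u ρ' (translate M' w n)
          + sgnK (trK (M2Of 3 L₂ (compMix (ctrOff (3 + 1) Lc) Lc m) j κ u ρ' (translate M' w n))))) x z a c)
    (κ : Fin (3 + 1)) (u x : Site (3 + 1)) (α γ : Fin (3 + 1)) :
    ∀ z ∉ (Fintype.piFinset fun _ : Fin (3 + 1) => Finset.Icc (-(wid Lc m : ℤ)) (wid Lc m : ℤ)).image (fun v => x - v),
      V κ u x z (Sum.inl α) (Sum.inl γ) = 0 := fun z hz => by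
  subst hV
  exact (tsum_congr fun n => compMixedT2_even_inl_inl_eq_zero_of_not_mem_S L₂ j m κ u ρ' _ x α γ z hz).trans tsum_zero

/-- [folklore] **THE COPIES COME OUT OF THE LATTICE CONTRACTION**: for every lattice function `λ` and `ff` entry,
`Σ'_u Σ_κ (λ(u+e_κ) − λ u)·V κ u x z (inl α) (inl γ) = Σ'_n Σ'_u Σ_κ (λ(u+e_κ) − λ u)·M2ᵉ κ u ρ′ (w + M′∘n) x z (inl α) (inl γ)` — the fine-bond sum is a window sum
(`hT`, uniform over the copies), the copy sum converges termwise (left-leg window), finite sums commute with it. -/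
theorem tsum_sum_dz_mul_compMixedT2per_even_inl_inl
    (hV : V = fun κ u x z a c => ∑' n : Site (3 + 1),
      ((1 / 2 : ℝ) • (M2Of 3 L₂ (compMix (ctrOff (3 + 1) Lc) Lc m) j κ u ρ' (translate M' w n)
          + sgnK (trK (M2Of 3 L₂ (compMix (ctrOff (3 + 1) Lc) Lc m) j κ u ρ' (translate M' w n))))) x z a c)
    (lam : Site (3 + 1) → ℝ) (x z : Site (3 + 1)) (α γ : Fin (3 + 1)) :
    ∑' u : Site (3 + 1), ∑ κ : Fin (3 + 1), dz lam κ u * V κ u x z (Sum.inl α) (Sum.inl γ)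
      = ∑' n : Site (3 + 1), ∑' u : Site (3 + 1), ∑ κ : Fin (3 + 1), dz lam κ u *
          ((1 / 2 : ℝ) • (M2Of 3 L₂ (compMix (ctrOff (3 + 1) Lc) Lc m) j κ u ρ' (translate M' w n)
            + sgnK (trK (M2Of 3 L₂ (compMix (ctrOff (3 + 1) Lc) Lc m) j κ u ρ' (translate M' w n))))) x z (Sum.inl α) (Sum.inl γ) := by
  set Tx : Finset (Site (3 + 1)) := (Fintype.piFinset fun _ : Fin (3 + 1) => Finset.Icc (-(wid Lc m : ℤ)) (wid Lc m : ℤ)).image (fun v => x - v) with hTx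
  have hT := compMixedT2per_even_inl_inl_eq_zero_of_not_mem_T L₂ j m ρ' w hV
  -- the fine-bond sum of the family is a window sum
  rw [tsum_eq_sum (s := Tx) fun u hu => Finset.sum_eq_zero fun κ _ => by rw [hT κ x z α γ u hu, mul_zero]]
  -- each copy's fine-bond sum is the same window sum
  have hcopy : ∀ n : Site (3 + 1), (∑' u : Site (3 + 1), ∑ κ : Fin (3 + 1), dz lam κ u *
          ((1 / 2 : ℝ) • (M2Of 3 L₂ (compMix (ctrOff (3 + 1) Lc) Lc m) j κ u ρ' (translate M' w n)
            + sgnK (trK (M2Of 3 L₂ (compMix (ctrOff (3 + 1) Lc) Lc m) j κ u ρ' (translate M' w n))))) x z (Sum.inl α) (Sum.inl γ))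
      = ∑ u ∈ Tx, ∑ κ : Fin (3 + 1), dz lam κ u *
          ((1 / 2 : ℝ) • (M2Of 3 L₂ (compMix (ctrOff (3 + 1) Lc) Lc m) j κ u ρ' (translate M' w n)
            + sgnK (trK (M2Of 3 L₂ (compMix (ctrOff (3 + 1) Lc) Lc m) j κ u ρ' (translate M' w n))))) x z (Sum.inl α) (Sum.inl γ) := fun n =>
    tsum_eq_sum fun u hu => Finset.sum_eq_zero fun κ _ => by
      rw [compMixedT2_even_inl_inl_eq_zero_of_not_mem_T L₂ j m κ ρ' _ x z α γ u hu, mul_zero]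
  simp only [hcopy]
  subst hV
  have hs : ∀ (u : Site (3 + 1)) (κ : Fin (3 + 1)), Summable fun n : Site (3 + 1) => dz lam κ u *
      ((1 / 2 : ℝ) • (M2Of 3 L₂ (compMix (ctrOff (3 + 1) Lc) Lc m) j κ u ρ' (translate M' w n)
        + sgnK (trK (M2Of 3 L₂ (compMix (ctrOff (3 + 1) Lc) Lc m) j κ u ρ' (translate M' w n))))) x z (Sum.inl α) (Sum.inl γ) := fun u κ =>
    (summable_compMixedT2_even_translate_inl_inl (M' := M') L₂ j m ρ' w κ u x z α γ).mul_left _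
  rw [Summable.tsum_finsetSum fun u _ => summable_sum fun κ _ => hs u κ]
  refine Finset.sum_congr rfl fun u _ => ?_
  rw [Summable.tsum_finsetSum fun κ _ => hs u κ]
  refine Finset.sum_congr rfl fun κ _ => ?_
  rw [← tsum_mul_left]

end Family

/-! ## §3 PART 32 per copy: the lattice contraction of the even composite table of depth `m+1` with a pure gauge — top storey written out, lower storey = the top linear
brick times the same contraction of the depth-`m` table at the window bonds -/

section Lattice

variable (L₂ j m : ℕ)

/-- [folklore] **THE LATTICE CONTRACTION PER COPY, DEPTH `m+1`** (PART 32 `CombMixedT2EvenStoreyRec.tsum_sum_grad_mul_compMixKer_succ_even` in the table's letters): for every lattice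
function `λ`, coarse bond `(ρ′, y)` at level `m+1` and `ff` entry,
`Σ'_u Σ_κ (λ(u+e_κ) − λ u)·M2ᵉ_{m+1} κ u ρ′ y x z (inl α) (inl γ) = wM2 L₂ j · Σ_{κ₁e₁κ₂e₂} (λ(R_m(Lc•y+e₂)) − λ(R_m(Lc•y+e₁)))·h(ρ′,y;b₁,b₂)·compLin_m((α,x);b₁)·compLin_m((γ,z);b₂)
 + Σ_{κ,e} ℓ(ρ′,y;b)·Σ'_u Σ_κ′ (λ(u+e_κ′) − λ u)·M2ᵉ_m κ′ u κ (Lc•y+e) x z (inl α) (inl γ)` (`b = (κ, Lc•y+e)`, `R_m v = Lc^m•v + Σ_{k<m} Lc^k•ρ_c`). -/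
theorem tsum_sum_dz_mul_compMixedT2_even_succ_inl_inl (lam : Site (3 + 1) → ℝ) (ρ' : Fin (3 + 1)) (y x z : Site (3 + 1)) (α γ : Fin (3 + 1)) :
    ∑' u : Site (3 + 1), ∑ κ : Fin (3 + 1), dz lam κ u *
        ((1 / 2 : ℝ) • (M2Of 3 L₂ (compMix (ctrOff (3 + 1) Lc) Lc (m + 1)) j κ u ρ' y + sgnK (trK (M2Of 3 L₂ (compMix (ctrOff (3 + 1) Lc) Lc (m + 1)) j κ u ρ' y)))) x z
          (Sum.inl α) (Sum.inl γ)
      = wM2 3 L₂ j * (∑ κ₁ : Fin (3 + 1), ∑ e₁ ∈ offs Lc, ∑ κ₂ : Fin (3 + 1), ∑ e₂ ∈ offs Lc,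
          (lam (((Lc ^ m : ℕ) : ℤ) • ((Lc : ℤ) • y + e₂) + ∑ k ∈ Finset.range m, ((Lc ^ k : ℕ) : ℤ) • ctr 4 Lc)
              - lam (((Lc ^ m : ℕ) : ℤ) • ((Lc : ℤ) • y + e₁) + ∑ k ∈ Finset.range m, ((Lc ^ k : ℕ) : ℤ) • ctr 4 Lc))
            * symHessKerAt (ctr 4 Lc) Lc ρ' y (κ₁, (Lc : ℤ) • y + e₁) (κ₂, (Lc : ℤ) • y + e₂)
            * compLinKer (fun _ => symLinKerAt (ctr 4 Lc) Lc) Lc m (α, x) (κ₁, (Lc : ℤ) • y + e₁)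
            * compLinKer (fun _ => symLinKerAt (ctr 4 Lc) Lc) Lc m (γ, z) (κ₂, (Lc : ℤ) • y + e₂))
        + ∑ κ : Fin (3 + 1), ∑ e ∈ offs Lc, symLinKerAt (ctr 4 Lc) Lc ρ' y (κ, (Lc : ℤ) • y + e)
            * ∑' u : Site (3 + 1), ∑ κ' : Fin (3 + 1), dz lam κ' u *
                ((1 / 2 : ℝ) • (M2Of 3 L₂ (compMix (ctrOff (3 + 1) Lc) Lc m) j κ' u κ ((Lc : ℤ) • y + e)
                  + sgnK (trK (M2Of 3 L₂ (compMix (ctrOff (3 + 1) Lc) Lc m) j κ' u κ ((Lc : ℤ) • y + e))))) x z (Sum.inl α) (Sum.inl γ) := by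
  have h32 := tsum_sum_grad_mul_compMixKer_succ_even (Lc := Lc) lam m ρ' y (α, x) (γ, z)
  -- the depth-(m+1) table's even entry as `wM2 ·` PART 32's integrand
  have lhs : (∑' u : Site (3 + 1), ∑ κ : Fin (3 + 1), dz lam κ u *
        ((1 / 2 : ℝ) • (M2Of 3 L₂ (compMix (ctrOff (3 + 1) Lc) Lc (m + 1)) j κ u ρ' y + sgnK (trK (M2Of 3 L₂ (compMix (ctrOff (3 + 1) Lc) Lc (m + 1)) j κ u ρ' y)))) x z
          (Sum.inl α) (Sum.inl γ))
      = wM2 3 L₂ j * ∑' u : Site (3 + 1), ∑ κ : Fin (3 + 1), (lam (u + unitVec κ) - lam u)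
        * ((1 / 2 : ℝ) * (compMixKer (fun _ => symLinKerAt (ctr 4 Lc) Lc) (fun _ => symVhKerAt (ctr 4 Lc) Lc) (fun _ => symHessKerAt (ctr 4 Lc) Lc)
              (fun _ => symMixKerAt (ctr 4 Lc) Lc) Lc (m + 1) ρ' y (κ, u) (α, x) (γ, z)
            + compMixKer (fun _ => symLinKerAt (ctr 4 Lc) Lc) (fun _ => symVhKerAt (ctr 4 Lc) Lc) (fun _ => symHessKerAt (ctr 4 Lc) Lc)
              (fun _ => symMixKerAt (ctr 4 Lc) Lc) Lc (m + 1) ρ' y (κ, u) (γ, z) (α, x))) := by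
    rw [← tsum_mul_left]
    refine tsum_congr fun u => ?_
    rw [Finset.mul_sum]
    refine Finset.sum_congr rfl fun κ _ => ?_
    rw [compMixedT2_even_inl_inl, compMix_inl_inl, compMix_inl_inl, dz]
    ring
  -- the depth-`m` tables' even entries likewise, at each window bond
  have low : ∀ (κ : Fin (3 + 1)) (e : Site (3 + 1)), (∑' u : Site (3 + 1), ∑ κ' : Fin (3 + 1), dz lam κ' u *
        ((1 / 2 : ℝ) • (M2Of 3 L₂ (compMix (ctrOff (3 + 1) Lc) Lc m) j κ' u κ ((Lc : ℤ) • y + e)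
          + sgnK (trK (M2Of 3 L₂ (compMix (ctrOff (3 + 1) Lc) Lc m) j κ' u κ ((Lc : ℤ) • y + e))))) x z (Sum.inl α) (Sum.inl γ))
      = wM2 3 L₂ j * ∑' u : Site (3 + 1), ∑ κ' : Fin (3 + 1), (lam (u + unitVec κ') - lam u)
        * ((1 / 2 : ℝ) * (compMixKer (fun _ => symLinKerAt (ctr 4 Lc) Lc) (fun _ => symVhKerAt (ctr 4 Lc) Lc) (fun _ => symHessKerAt (ctr 4 Lc) Lc)
              (fun _ => symMixKerAt (ctr 4 Lc) Lc) Lc m κ ((Lc : ℤ) • y + e) (κ', u) (α, x) (γ, z)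
            + compMixKer (fun _ => symLinKerAt (ctr 4 Lc) Lc) (fun _ => symVhKerAt (ctr 4 Lc) Lc) (fun _ => symHessKerAt (ctr 4 Lc) Lc)
              (fun _ => symMixKerAt (ctr 4 Lc) Lc) Lc m κ ((Lc : ℤ) • y + e) (κ', u) (γ, z) (α, x))) := fun κ e => by
    rw [← tsum_mul_left]
    refine tsum_congr fun u => ?_
    rw [Finset.mul_sum]
    refine Finset.sum_congr rfl fun κ' _ => ?_
    rw [compMixedT2_even_inl_inl, compMix_inl_inl, compMix_inl_inl, dz]
    ring
  rw [lhs, h32, mul_add]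
  congr 1
  rw [Finset.mul_sum]
  refine Finset.sum_congr rfl fun κ _ => ?_
  rw [Finset.mul_sum]
  refine Finset.sum_congr rfl fun e _ => ?_
  rw [low κ e]
  ring

end Lattice

end Summit.QuantumFields.BalabanUV.Beta.CombMixedT2EvenStoreyPeriodised

end
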